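import Mathlib
import Summits.AtomisticToContinuum.Crystallization.Theses.PalmUnimodularRigidity
import Literature.Probability.Process.PointStationaryLaw
import Literature.MathematicalPhysics.StatisticalMechanics.RootEnergy

/-!
# Sketch (crux-ideate, round 1, ideator 3) — first lemmas of the line `ring-flatness-six-ring-tax`
for crux `PalmUnimodularRigidity.MinimiserShells` (stmt-AtomisticToContinuum-9225).

Only SIGNATURES are claimed to be meaningful here (crux-ideate files no skeleton). Everything is
stated over Mathlib + the tree (`IsPointStationaryLaw`, `IsRootedHardCore`, `rootEnergy`,
`lennardJones`, `PeriodicConfiguration.energyPerParticle`).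

* `IsClosedRingStar n η a x y z` — the bond `(x,y)` ("axis") with a CLOSED ring `z : Fin n → ℝ³`
  of common neighbours: axis, the `2n` spokes and the `n` consecutive ring bonds all have length
  `≤ a(1+η)`, and all `n+2` points are pairwise `≥ a(1−η)` apart (hard core = lower window edge).
* `FiveRingFrustration` — no `1/200`-closed five-ring star (flat-space deficit
  `2π − 5·arccos(1/3) ≈ 7.36°`; threshold `η⋆ ≈ 0.0067` is exactly the one recorded with negative
  stmt-4146, the D5h shell).
* `SixRingStretch` — no `1/25`-closed six-ring star (six tetrahedra overlap by
  `6·arccos(1/3) − 2π ≈ 63.2°`; closure needs an intra-star length spread ≥ ≈ 11 %, i.e.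
  `η ≥ η₆ ≈ 0.046–0.056`): the −72° disclination bond of Frank–Kasper order is ≥ 4 % strained.
* `SixRingSpread` — the quantitative (ℓ²) form the pricing uses: a closed six-ring star at the
  loose window `1/5` carries total squared strain `≥ σ₆ > 0` on its `19` bonds.
* `RingPurityAS` — the measure-level target of the line (shape only): for minimising
  point-stationary hard-core laws, a.s. every radial bond of the root at scale `a` is a closed
  FOUR-ring (octahedral order), which with twelve-coordination pins the cuboctahedron /
  anticuboctahedron.
-/

namespace Summit.AtomisticToContinuum.Crystallization.Cruxes.MinimiserShells.RingFlatness

open MeasureTheory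
open Literature.Probability.Process
open Literature.MathematicalPhysics.StatisticalMechanics

noncomputable section

abbrev E3 := EuclideanSpace ℝ (Fin 3)

/-- The `n + 2` points of a ring star: the axis ends `x, y` and the ring `z`. -/
def starPoints {n : ℕ} (x y : E3) (z : Fin n → E3) : Set E3 := {x, y} ∪ Set.range z

/-- `η`-closed ring star of order `n` at scale `a` around the bond `(x, y)` (see module doc). -/
def IsClosedRingStar (n : ℕ) [NeZero n] (η a : ℝ) (x y : E3) (z : Fin n → E3) : Prop :=
  x ≠ y ∧ Function.Injective z ∧ (∀ i, z i ≠ x ∧ z i ≠ y) ∧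
  (∀ p ∈ starPoints x y z, ∀ q ∈ starPoints x y z, p ≠ q → a * (1 - η) ≤ dist p q) ∧
  dist x y ≤ a * (1 + η) ∧
  (∀ i, dist x (z i) ≤ a * (1 + η) ∧ dist y (z i) ≤ a * (1 + η)) ∧
  (∀ i : Fin n, dist (z i) (z (i + 1)) ≤ a * (1 + η))

/-- Total squared strain of the `3n + 1` bonds of a ring star, relative to the scale `a`. -/
def starStrainSq {n : ℕ} [NeZero n] (a : ℝ) (x y : E3) (z : Fin n → E3) : ℝ :=
  (dist x y / a - 1) ^ 2 +
    ∑ i : Fin n, ((dist x (z i) / a - 1) ^ 2 + (dist y (z i) / a - 1) ^ 2 +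
      (dist (z i) (z (i + 1)) / a - 1) ^ 2)

/-- FIRST LEMMA (L∞ five-ring frustration): a five-ring of common neighbours cannot close inside
the window `[a(1 − 1/200), a(1 + 1/200)]`. Proof sketch: ring points lie within height `2η/ℓ` of
the bisector plane of the axis and at distance `ρ ≤ √((1+η)² − (1−η)²/4)·a` from it; consecutive
projected chords are `≥ a√((1−η)² − 16η²)`; the angular step is then `< 72°` for `η = 1/200`
(ratio `0.5696 < sin 36° = 0.5878`), so five steps cannot wind once around the axis. -/
def FiveRingFrustration : Prop :=
  ∀ a : ℝ, 0 < a → ∀ x y : E3, ∀ z : Fin 5 → E3, ¬ IsClosedRingStar 5 (1 / 200) a x y z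

/-- Six-ring stretch (L∞ form): a six-ring cannot close inside `[a(1 − 1/25), a(1 + 1/25)]`
(same projection argument: the angular step is `> 60°` as long as
`√((1−η)² − 16η²/(1−η)²) > √((1+η)² − (1−η)²/4)`, which holds at `η = 1/25` with ratio `0.512`). -/
def SixRingStretch : Prop :=
  ∀ a : ℝ, 0 < a → ∀ x y : E3, ∀ z : Fin 6 → E3, ¬ IsClosedRingStar 6 (1 / 25) a x y z

/-- Six-ring spread (ℓ² form, the one the first-shell pricing uses): inside the LOOSE window
`1/5` every closed six-ring star carries a definite total squared strain `σ₆` on its 19 bonds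
(linearised estimate `σ₆ ≈ (1.107 / ‖∇_s Σdih‖)² ≈ 0.03`; to be certified). -/
def SixRingSpread : Prop :=
  ∃ σ₆ : ℝ, 0 < σ₆ ∧ ∀ a : ℝ, 0 < a → ∀ x y : E3, ∀ z : Fin 6 → E3,
    IsClosedRingStar 6 (1 / 5) a x y z → σ₆ ≤ starStrainSq a x y z

/-- The points of a rooted configuration `μ` (counting measure) as a set. -/
def pts (μ : Measure E3) : Set E3 := {y | μ {y} ≠ 0}

/-- Common neighbours of the root `0` and a radial bond end `y`, inside the bond window at
scale `a` with tolerance `η`. -/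
def commonNbrs (η a : ℝ) (μ : Measure E3) (y : E3) : Set E3 :=
  {w | w ∈ pts μ ∧ w ≠ 0 ∧ w ≠ y ∧ dist 0 w ≤ a * (1 + η) ∧ dist y w ≤ a * (1 + η)}

/-- "Every radial bond of the root is a closed four-ring" at scale `a`, tolerance `η`: each point
`y ≠ 0` of `μ` with `‖y‖ ≤ a(1+η)` has exactly four common neighbours in the window and they can
be ordered cyclically with consecutive distances in the window (a square: two tetrahedra and two
half-octahedra around the bond — the Barlow signature; Frank–Kasper order has only 5- and
6-rings). -/
def AllFourRings (η a : ℝ) (μ : Measure E3) : Prop :=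
  ∀ y ∈ pts μ, y ≠ 0 → ‖y‖ ≤ a * (1 + η) →
    ∃ z : Fin 4 → E3, Function.Injective z ∧ Set.range z = commonNbrs η a μ y ∧
      ∀ i : Fin 4, dist (z i) (z (i + 1)) ≤ a * (1 + η)

/-- MEASURE-LEVEL TARGET OF THE LINE (shape): for every hard core `δ > 0` and every minimising
point-stationary `δ`-hard-core law, almost surely there is a scale `a ∈ [9/10, 1]` at which every
radial bond of the root (tolerance `1/50`) is a closed four-ring. The flatness/ring-calculus
pricing is what would prove it; combined with a.s. twelve-coordination and four-ring shell
rigidity it yields `MinimiserShells`. -/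
def RingPurityAS : Prop :=
  ∀ δ : ℝ, 0 < δ → ∀ P : Measure (Measure E3), IsProbabilityMeasure P →
    (∀ᵐ μ ∂P, IsRootedHardCore δ μ) → IsPointStationaryLaw P →
    (∫ μ, rootEnergy lennardJones μ ∂P) ≤
      (⨅ Q : PeriodicConfiguration 3, Q.energyPerParticle lennardJones) →
    ∀ᵐ μ ∂P, ∃ a : ℝ, 9 / 10 ≤ a ∧ a ≤ 1 ∧ AllFourRings (1 / 50) a μ

/-- Sanity: the crux decl is in scope by name (the line must eventually conclude it). -/
example : Prop := Summit.AtomisticToContinuum.Crystallization.Theses.PalmUnimodularRigidity.MinimiserShells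

end

end Summit.AtomisticToContinuum.Crystallization.Cruxes.MinimiserShells.RingFlatness
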